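/-
Copyright (c) 2026 the pub-hodgecm-mathlib formalisation cell (harness21).  Prover seat hodgecm-mathlib-A-p03 (g24); LEAD F0P3a-plan (g9) WORD T8-41 «(F4)–(F8) PEN 1»,
architect A-p06 (g26) («(C) coset level» 04:30:10Z, defs ★ p840993), 2026-09-01.
-/
import Literature.NumberTheory.Automorphic.UnitaryThreeBorelConjugateCongruences
import Literature.NumberTheory.Automorphic.UnitaryThreeDoubleCosetsHKDefs
import HarnessLib

/-!
# Flicker's Prop. 10, LAYER B: the elements of `P_H` in coordinates, and the coset counts in the regimes «empty», «none», «all»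

Topic `NumberTheory/Automorphic` (road «D-N7-inert», MAP v3 (F4) LAYER B); namespace `Literature.NumberTheory.Automorphic.UnitaryGroup` (B-p17 (g24)'s frame and
★ defs `flickerKH`, `flickerHK`, `flickerPH` p840993).  THEOREMS ONLY: no definition, no named fact, no instance, no notation, no `sorry`; kernel lane.

THE MATHEMATICS [Flicker1998UnitaryFL, Prop. 8 p. 84, Prop. 10 pp. 85–86].  §1 Every element of Flicker's `P_H` (★ `flickerPH` = `K_H ∩ B`) has matrix
`!![u, 0, u·x; 0, w, 0; 0, 0, (σu)⁻¹]` with `|u| = |w| = 1`, `σw·w = 1`, `x` integral and `σx = −x` (`exists_coe_eq_borel_of_mem_flickerPH`), and conversely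
(`exists_mem_flickerPH_coe_eq`).  §2 For such `p` and a block torus element `τ ∈ H` the condition «`p⁻¹ τ p ∈ H^K_m`» (★ `flickerHK c u_m`) is the four-congruence
system of ★ `borel_conj_mem_unitaryInt_iff` in `(n, x) = (uσu, x)`.  §3 THE COSET COUNT `#{y ∈ P_H ⧸ (P_H ∩ H^K_m) : y⁻¹ τ_j y ∈ H^K_m}` — the quantity Cor. 9 weights
(★ `natCard_fixedPoints_eq_finsum_relIndex_mul`, B-p04) — in the three «rigid» regimes of Prop. 10 (`j ≥ 1`, `τ_j` with `B₁ = B₂ϖ^{2j}`, `|B₂| = |ϖ^ν|`, `|A − b| = |ϖ^{N₊}|`):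
it is `0` when `m > ν` (`natCard_cosets_eq_zero_of_lt`), `0` when `m ≤ ν` but `N₊ < m` or (`2m > min(ν,N₊)` and `ν ≠ N₊`) (`natCard_cosets_eq_zero_of_ne`), and the
full index `[P_H : P_H ∩ H^K_m]` when `2m ≤ min(ν, N₊)` (`natCard_cosets_eq_index_of_le`) — i.e. ★ `iTen`'s values `0`, `0`, `(1 − q⁻²)q^{4m}` once (F3c-β) identifies the
index (Prop. 8, B-p04 (g33)).  The remaining regime `ν = N₊ < 2m ≤ 2ν` (value `(1+q⁻¹)q^{ν+2m}`, via ★ `condition_four_iff_quadratic` + the toolkit ★ p840933) is the sequel.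
HONEST LABEL: HC_CM is proved only modulo the printed citations until rung 0 closes; this file is group bookkeeping over a valued field.

## References
* [Flicker1998UnitaryFL] Y. Z. Flicker, *Elementary proof of the fundamental lemma for a unitary group*, Canad. J. Math. 50 (1998), 74–98: Prop. 8 p. 84, Prop. 10 pp. 85–86.
* [Rogawski1990] J. D. Rogawski, *Automorphic Representations of Unitary Groups in Three Variables* (1990), §4.9 p. 55.
-/

set_option autoImplicit false

open scoped MatrixGroups WithZero
open Matrix

namespace Literature.NumberTheory.Automorphic

namespace UnitaryGroup

open Literature.NumberTheory.Automorphic.HermitianLattice (unitaryInt mem_unitaryInt_iff LocalConjDatum)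

variable {K : Type*} [Field K] [Valued K ℤᵐ⁰] {ϖ : K}
  (σ : K →+* K) {J : Matrix (Fin 3) (Fin 3) K}

/-- `rev` on `Fin 3`. [folklore] -/ private theorem rev0' : Fin.rev (0 : Fin 3) = 2 := rfl
/-- `rev` on `Fin 3`. [folklore] -/ private theorem rev1' : Fin.rev (1 : Fin 3) = 1 := rfl
/-- `rev` on `Fin 3`. [folklore] -/ private theorem rev2' : Fin.rev (2 : Fin 3) = 0 := rfl

/-! ## §1 The elements of `P_H` in coordinates `(u, x, w)` -/

/-- **Shape of `P_H`** (Flicker p. 84: `P_H = {diag(u, ū⁻¹)·(1, λ√D; 0, 1)}` times the middle `E¹`): an element of ★ `flickerPH` has matrix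
`!![u, 0, u·x; 0, w, 0; 0, 0, (σu)⁻¹]` with `|u| = 1`, `|x| ≤ 1`, `σx = −x`, `|w| = 1`, `σw·w = 1`. [cite: Flicker1998UnitaryFL, Prop. 8 p. 84] -/
theorem exists_coe_eq_borel_of_mem_flickerPH (hJ : J = (StdForm.antidiagonal 3).over K) (hd : LocalConjDatum σ ϖ)
    {c p : ↥(unitaryGroupOfForm σ J)} (hc : ((c : GL (Fin 3) K) : Matrix (Fin 3) (Fin 3) K) = !![1, 0, 0; 0, -1, 0; 0, 0, 1])
    (hp : p ∈ flickerPH σ J c) :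
    ∃ u x w : K, ((p : GL (Fin 3) K) : Matrix (Fin 3) (Fin 3) K) = !![u, 0, u * x; 0, w, 0; 0, 0, (σ u)⁻¹] ∧
      Valued.v u = 1 ∧ Valued.v x ≤ 1 ∧ σ x = -x ∧ Valued.v w = 1 ∧ σ w * w = 1 := by
  have h2 : (2 : K) ≠ 0 := fun h => by have := hd.v2; rw [h, map_zero] at this; exact zero_ne_one this
  rw [mem_flickerPH_iff h2 hc, mem_flickerKH_iff] at hp
  obtain ⟨⟨hH, hK⟩, h20⟩ := hp
  obtain ⟨α, β, γ, δ, e, hblock⟩ := exists_coe_eq_block_of_mem_centralizer σ h2 hc hH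
  have hγ : γ = 0 := by
    have : ((p : GL (Fin 3) K) : Matrix (Fin 3) (Fin 3) K) 2 0 = γ := by rw [hblock]; rfl
    rw [← this, h20]
  subst hγ
  -- unitarity relations
  have r02 := sum_rel_of_mem σ hJ p 0 2
  have r22 := sum_rel_of_mem σ hJ p 2 2
  have r11 := sum_rel_of_mem σ hJ p 1 1
  rw [hblock] at r02 r22 r11
  simp only [Fin.sum_univ_three, rev0', rev1', rev2', Fin.isValue, if_true, show ¬ ((2 : Fin 3) = 0) by decide, if_false] at r02 r22 r11
  simp only [Matrix.of_apply, Matrix.cons_val', Matrix.cons_val_zero, Matrix.cons_val_one, Matrix.cons_val_fin_one, Matrix.cons_val,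
    Matrix.empty_val', map_zero, mul_zero, zero_mul, add_zero, zero_add] at r02 r22 r11
  -- r02 : σ α * δ = 1 ; r22 : σ β * δ + σ δ * β = 0 ; r11 : σ e * e = 1
  have hα0 : α ≠ 0 := by
    intro h; rw [h, map_zero, zero_mul] at r02; exact zero_ne_one r02
  have hσα0 : σ α ≠ 0 := fun h => hα0 (by rw [← hd.σσ α, h, map_zero])
  have hδ : δ = (σ α)⁻¹ := eq_inv_of_mul_eq_one_right r02
  -- integrality
  have hint := (mem_unitaryInt_iff_forall_v_apply_le_one σ hJ hd.vσ p).1 hK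
  have hvα : Valued.v α ≤ 1 := by have := hint 0 0; rw [hblock] at this; exact this
  have hvβ : Valued.v β ≤ 1 := by have := hint 0 2; rw [hblock] at this; exact this
  have hvδ : Valued.v δ ≤ 1 := by have := hint 2 2; rw [hblock] at this; exact this
  have hvα1 : Valued.v α = 1 := by
    refine le_antisymm hvα ?_
    rw [hδ, map_inv₀, hd.vσ] at hvδ
    by_contra hlt; push Not at hlt
    have : (1 : ℤᵐ⁰) < (Valued.v α)⁻¹ := one_lt_inv_iff₀.2 ⟨(Valuation.pos_iff _).2 hα0, hlt⟩
    exact absurd hvδ (not_le.2 this)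
  refine ⟨α, β / α, e, ?_, hvα1, ?_, ?_, v_eq_one_of_coe_eq_block σ hJ hd.vσ hblock, r11⟩
  · rw [hblock, hδ, mul_div_cancel₀ _ hα0]
  · rw [map_div₀, hvα1, div_one]; exact hvβ
  · -- σ(β/α) = σβ/σα = σβ·δ = −σδ·β = −β/α
    have hσδ : σ δ = α⁻¹ := by rw [hδ, map_inv₀, hd.σσ]
    rw [map_div₀, div_eq_mul_inv, ← hδ]
    rw [hσδ] at r22
    have : σ β * δ = -(α⁻¹ * β) := eq_neg_of_add_eq_zero_left r22
    rw [this, div_eq_mul_inv, mul_comm β]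

omit [Valued K ℤᵐ⁰] in
/-- Constructor: a `3 × 3` matrix with non-zero determinant satisfying the nine unitarity relations is (the matrix of) an element of `U(σ, Φ₃)`.
[cite: Rogawski1990, §1.9 p. 8] -/
private theorem exists_coe_eq_of_sum' (hJ : J = (StdForm.antidiagonal 3).over K) (M : Matrix (Fin 3) (Fin 3) K) (hdet : M.det ≠ 0)
    (hsum : ∀ a b : Fin 3, ∑ i, σ (M i a) * M (Fin.rev i) b = if b = Fin.rev a then 1 else 0) :
    ∃ g : ↥(unitaryGroupOfForm σ J), ((g : GL (Fin 3) K) : Matrix (Fin 3) (Fin 3) K) = M := by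
  have hmem : Matrix.GeneralLinearGroup.mkOfDetNeZero M hdet ∈ unitaryGroupOfForm σ J := by
    rw [hJ, mem_unitaryGroupOfForm_antidiagonal_iff_sum']
    simpa [Matrix.GeneralLinearGroup.val_mkOfDetNeZero] using hsum
  exact ⟨⟨_, hmem⟩, Matrix.GeneralLinearGroup.val_mkOfDetNeZero _ _⟩

/-- **Converse: the literal `!![u, 0, u·x; 0, w, 0; 0, 0, (σu)⁻¹]` with `|u| = |w| = 1`, `σw·w = 1`, `|x| ≤ 1`, `σx = −x` is an element of `P_H`.**
[cite: Flicker1998UnitaryFL, Prop. 8 p. 84] -/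
theorem exists_mem_flickerPH_coe_eq (hJ : J = (StdForm.antidiagonal 3).over K) (hd : LocalConjDatum σ ϖ)
    {c : ↥(unitaryGroupOfForm σ J)} (hc : ((c : GL (Fin 3) K) : Matrix (Fin 3) (Fin 3) K) = !![1, 0, 0; 0, -1, 0; 0, 0, 1])
    {u x w : K} (hu : Valued.v u = 1) (hx : Valued.v x ≤ 1) (hσx : σ x = -x) (hw : Valued.v w = 1) (hσw : σ w * w = 1) :
    ∃ p : ↥(unitaryGroupOfForm σ J), p ∈ flickerPH σ J c ∧
      ((p : GL (Fin 3) K) : Matrix (Fin 3) (Fin 3) K) = !![u, 0, u * x; 0, w, 0; 0, 0, (σ u)⁻¹] := by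
  have h2 : (2 : K) ≠ 0 := fun h => by have := hd.v2; rw [h, map_zero] at this; exact zero_ne_one this
  have hu0 : u ≠ 0 := fun h => by rw [h, map_zero] at hu; exact zero_ne_one hu
  have hσu0 : σ u ≠ 0 := fun h => hu0 (by rw [← hd.σσ u, h, map_zero])
  have hw0 : w ≠ 0 := fun h => by rw [h, map_zero] at hw; exact zero_ne_one hw
  have hσσu : σ (σ u) = u := hd.σσ u
  have hσσx : σ (σ x) = x := hd.σσ x
  have hdet : (!![u, 0, u * x; 0, w, 0; 0, 0, (σ u)⁻¹] : Matrix (Fin 3) (Fin 3) K).det ≠ 0 := by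
    rw [Matrix.det_fin_three]; simp [hu0, hσu0, hw0]
  have hsum : ∀ a b : Fin 3, ∑ i, σ ((!![u, 0, u * x; 0, w, 0; 0, 0, (σ u)⁻¹] : Matrix (Fin 3) (Fin 3) K) i a) *
      (!![u, 0, u * x; 0, w, 0; 0, 0, (σ u)⁻¹] : Matrix (Fin 3) (Fin 3) K) (Fin.rev i) b = if b = Fin.rev a then 1 else 0 := by
    intro a b
    fin_cases a <;> fin_cases b <;>
      simp [Fin.sum_univ_three, rev1', rev2', map_mul, map_inv₀, hσσu, hσx, hσu0, hu0, hσw]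
    field_simp
    ring
  obtain ⟨p, hp⟩ := exists_coe_eq_of_sum' σ hJ _ hdet hsum
  refine ⟨p, ?_, hp⟩
  rw [mem_flickerPH_iff h2 hc, mem_flickerKH_iff]
  refine ⟨⟨?_, ?_⟩, by rw [hp]; rfl⟩
  · -- commutes with `c = diag(1,−1,1)`
    rw [Subgroup.mem_centralizer_singleton_iff]
    apply Subtype.ext; apply Units.ext
    rw [Subgroup.coe_mul, Subgroup.coe_mul, Units.val_mul, Units.val_mul, hp, hc]
    ext i j
    fin_cases i <;> fin_cases j <;> simp [Matrix.mul_apply, Fin.sum_univ_three]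
  · -- integral
    rw [mem_unitaryInt_iff_forall_v_apply_le_one σ hJ hd.vσ]
    intro i j
    rw [hp]
    have hvσu : (Valued.v (σ u))⁻¹ ≤ 1 := by rw [hd.vσ, hu, inv_one]
    have hux : Valued.v u * Valued.v x ≤ 1 := by rw [hu, one_mul]; exact hx
    fin_cases i <;> fin_cases j <;> simp [hu.le, hw.le, hvσu, hux]

/-! ## §2 «`p⁻¹ τ p ∈ H^K_m`» for `p ∈ P_H` in coordinates -/

/-- **The conjugation condition in coordinates**: for `p ∈ U` with matrix `!![u,0,u·x; 0,w,0; 0,0,(σu)⁻¹]`, a block torus element `τ ∈ H` with matrix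
`!![A,0,B₁; 0,b,0; B₂,0,A]`, and Flicker's `u_m`: `p⁻¹ τ p ∈ H^K_m` iff the four congruences of ★ `borel_conj_mem_unitaryInt_iff` hold in `(n, x) = (uσu, x)`.
[cite: Flicker1998UnitaryFL, Prop. 10 pp. 85–86] -/
theorem borel_conj_mem_flickerHK_iff (hJ : J = (StdForm.antidiagonal 3).over K) (hd : LocalConjDatum σ ϖ) {y : K} (hy : y * σ y = -2) (m : ℕ)
    {c um p τ : ↥(unitaryGroupOfForm σ J)} {u x w A B₁ B₂ b : K} (hu : u ≠ 0) (hσu : σ u ≠ 0) (hw : w ≠ 0)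
    (hum : ((um : GL (Fin 3) K) : Matrix (Fin 3) (Fin 3) K) = !![ϖ ^ m, y, (ϖ ^ m)⁻¹; 0, 1, -σ y * (ϖ ^ m)⁻¹; 0, 0, (ϖ ^ m)⁻¹])
    (hp : ((p : GL (Fin 3) K) : Matrix (Fin 3) (Fin 3) K) = !![u, 0, u * x; 0, w, 0; 0, 0, (σ u)⁻¹])
    (hτ : ((τ : GL (Fin 3) K) : Matrix (Fin 3) (Fin 3) K) = !![A, 0, B₁; 0, b, 0; B₂, 0, A])
    (hpH : p ∈ Subgroup.centralizer ({c} : Set ↥(unitaryGroupOfForm σ J))) (hτH : τ ∈ Subgroup.centralizer ({c} : Set ↥(unitaryGroupOfForm σ J))) :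
    p⁻¹ * τ * p ∈ flickerHK σ J c um ↔
      Valued.v ((u * σ u) * B₂) ≤ 1 ∧
      Valued.v (A - b + (u * σ u) * B₂ * (1 - x)) ≤ Valued.v (ϖ ^ m) ∧
      Valued.v (A - b + (u * σ u) * B₂ * (1 + x)) ≤ Valued.v (ϖ ^ m) ∧
      Valued.v (2 * (A - b) + B₁ * (u * σ u)⁻¹ + (u * σ u) * B₂ * (1 - x ^ 2)) ≤ Valued.v (ϖ ^ m) * Valued.v (ϖ ^ m) := by
  rw [mem_flickerHK_iff]
  have hH : p⁻¹ * τ * p ∈ Subgroup.centralizer ({c} : Set ↥(unitaryGroupOfForm σ J)) :=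
    Subgroup.mul_mem _ (Subgroup.mul_mem _ (Subgroup.inv_mem _ hpH) hτH) hpH
  rw [and_iff_right hH]
  exact borel_conj_mem_unitaryInt_iff σ hJ hd hy m hu hσu hw hum hp hτ

/-! ## §3 The coset count in the rigid regimes of Prop. 10 -/

/-- If NO element of `P_H` conjugates `τ` into `H^K_m`, the coset count is `0`. [cite: Flicker1998UnitaryFL, Prop. 10 p. 85] -/
theorem natCard_cosets_eq_zero_of_forall_not {c um τ : ↥(unitaryGroupOfForm σ J)}
    (h : ∀ p ∈ flickerPH σ J c, p⁻¹ * τ * p ∉ flickerHK σ J c um) :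
    Nat.card {y : ↥(flickerPH σ J c) ⧸ (flickerHK σ J c um).subgroupOf (flickerPH σ J c) //
      ((Quotient.out y : ↥(flickerPH σ J c)) : ↥(unitaryGroupOfForm σ J))⁻¹ * τ * (Quotient.out y : ↥(flickerPH σ J c)) ∈ flickerHK σ J c um} = 0 := by
  rw [Nat.card_eq_zero]
  left
  refine ⟨fun ⟨y, hy⟩ => h _ (Quotient.out y).2 hy⟩

/-- If EVERY element of `P_H` conjugates `τ` into `H^K_m`, the coset count is the index `[P_H : P_H ∩ H^K_m]` (= `(1 − q⁻²)q^{4m}` for `m ≥ 1`, Prop. 8 — (F3c-β)).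
[cite: Flicker1998UnitaryFL, Prop. 10 p. 85; Prop. 8 p. 84] -/
theorem natCard_cosets_eq_index_of_forall {c um τ : ↥(unitaryGroupOfForm σ J)}
    (h : ∀ p ∈ flickerPH σ J c, p⁻¹ * τ * p ∈ flickerHK σ J c um) :
    Nat.card {y : ↥(flickerPH σ J c) ⧸ (flickerHK σ J c um).subgroupOf (flickerPH σ J c) //
      ((Quotient.out y : ↥(flickerPH σ J c)) : ↥(unitaryGroupOfForm σ J))⁻¹ * τ * (Quotient.out y : ↥(flickerPH σ J c)) ∈ flickerHK σ J c um} =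
      ((flickerHK σ J c um).subgroupOf (flickerPH σ J c)).index := by
  rw [Subgroup.index]
  exact Nat.card_congr (Equiv.subtypeUnivEquiv fun y => h _ (Quotient.out y).2)

/-- **Regime «`m > ν` is empty» as a coset count**: for `τ = !![A,0,B₂ϖ^{2j}; 0,b,0; B₂,0,A] ∈ H` with `j ≥ 1` and `|ϖ^m| < |B₂|` (i.e. `m > ν`), NO coset of
`P_H ∩ H^K_m` in `P_H` conjugates `τ` into `H^K_m`: the count is `0` (★ `iTen`: `m > ν ≥ [ν∕2]` and `m ≤ ν` fails in the third case). [cite: Flicker1998UnitaryFL, Prop. 10 p. 86] -/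
theorem natCard_cosets_eq_zero_of_lt (hJ : J = (StdForm.antidiagonal 3).over K) (hd : LocalConjDatum σ ϖ) {y : K} (hy : y * σ y = -2) (m : ℕ)
    {c um τ : ↥(unitaryGroupOfForm σ J)} (hc : ((c : GL (Fin 3) K) : Matrix (Fin 3) (Fin 3) K) = !![1, 0, 0; 0, -1, 0; 0, 0, 1])
    (hum : ((um : GL (Fin 3) K) : Matrix (Fin 3) (Fin 3) K) = !![ϖ ^ m, y, (ϖ ^ m)⁻¹; 0, 1, -σ y * (ϖ ^ m)⁻¹; 0, 0, (ϖ ^ m)⁻¹])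
    {A B₂ b : K} {j : ℕ} (hj : 1 ≤ j) (hB₂0 : B₂ ≠ 0)
    (hτ : ((τ : GL (Fin 3) K) : Matrix (Fin 3) (Fin 3) K) = !![A, 0, B₂ * ϖ ^ (2 * j); 0, b, 0; B₂, 0, A])
    (hτH : τ ∈ Subgroup.centralizer ({c} : Set ↥(unitaryGroupOfForm σ J))) (hlt : Valued.v (ϖ ^ m) < Valued.v B₂) :
    Nat.card {y : ↥(flickerPH σ J c) ⧸ (flickerHK σ J c um).subgroupOf (flickerPH σ J c) //
      ((Quotient.out y : ↥(flickerPH σ J c)) : ↥(unitaryGroupOfForm σ J))⁻¹ * τ * (Quotient.out y : ↥(flickerPH σ J c)) ∈ flickerHK σ J c um} = 0 := by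
  have h2 : (2 : K) ≠ 0 := fun h => by have := hd.v2; rw [h, map_zero] at this; exact zero_ne_one this
  refine natCard_cosets_eq_zero_of_forall_not σ fun p hp hmem => ?_
  obtain ⟨u, x, w, hpm, hvu, hvx, hσx, hvw, hσw⟩ := exists_coe_eq_borel_of_mem_flickerPH σ hJ hd hc hp
  have hu0 : u ≠ 0 := fun h => by rw [h, map_zero] at hvu; exact zero_ne_one hvu
  have hσu0 : σ u ≠ 0 := fun h => hu0 (by rw [← hd.σσ u, h, map_zero])
  have hw0 : w ≠ 0 := fun h => by rw [h, map_zero] at hvw; exact zero_ne_one hvw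
  have hpH : p ∈ Subgroup.centralizer ({c} : Set ↥(unitaryGroupOfForm σ J)) := ((mem_flickerPH_iff h2 hc).1 hp).1.1
  obtain ⟨-, h₂, h₃, h₄⟩ := (borel_conj_mem_flickerHK_iff σ hJ hd hy m hu0 hσu0 hw0 hum hpm hτ hpH hτH).1 hmem
  have hn : Valued.v (u * σ u) = 1 := by rw [map_mul, hd.vσ, hvu, mul_one]
  have := v_B₂_le_of_conditions σ hd hj hB₂0 hn hvx rfl h₂ h₃ h₄
  exact absurd hlt (not_lt.2 this)

/-- **Regime «no solution» as a coset count**: `m ≤ ν` (`|B₂| ≤ |t|`) but EITHER `N₊ < m` (`|t| < |A − b|`) OR the valuations `|A−b| ≠ |B₂|` with `max > |t|²`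
(`2m > min(ν, N₊)`, `ν ≠ N₊`): the count is `0`. [cite: Flicker1998UnitaryFL, Prop. 10 p. 86] -/
theorem natCard_cosets_eq_zero_of_ne (hJ : J = (StdForm.antidiagonal 3).over K) (hd : LocalConjDatum σ ϖ) {y : K} (hy : y * σ y = -2) (m : ℕ)
    {c um τ : ↥(unitaryGroupOfForm σ J)} (hc : ((c : GL (Fin 3) K) : Matrix (Fin 3) (Fin 3) K) = !![1, 0, 0; 0, -1, 0; 0, 0, 1])
    (hum : ((um : GL (Fin 3) K) : Matrix (Fin 3) (Fin 3) K) = !![ϖ ^ m, y, (ϖ ^ m)⁻¹; 0, 1, -σ y * (ϖ ^ m)⁻¹; 0, 0, (ϖ ^ m)⁻¹])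
    {A B₂ b : K} {j : ℕ} (hj : 1 ≤ j) (hB₂0 : B₂ ≠ 0)
    (hτ : ((τ : GL (Fin 3) K) : Matrix (Fin 3) (Fin 3) K) = !![A, 0, B₂ * ϖ ^ (2 * j); 0, b, 0; B₂, 0, A])
    (hτH : τ ∈ Subgroup.centralizer ({c} : Set ↥(unitaryGroupOfForm σ J))) (hB₂m : Valued.v B₂ ≤ Valued.v (ϖ ^ m))
    (hbad : Valued.v (ϖ ^ m) < Valued.v (A - b) ∨
      (Valued.v (A - b) ≠ Valued.v B₂ ∧ Valued.v (ϖ ^ m) * Valued.v (ϖ ^ m) < max (Valued.v (A - b)) (Valued.v B₂))) :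
    Nat.card {y : ↥(flickerPH σ J c) ⧸ (flickerHK σ J c um).subgroupOf (flickerPH σ J c) //
      ((Quotient.out y : ↥(flickerPH σ J c)) : ↥(unitaryGroupOfForm σ J))⁻¹ * τ * (Quotient.out y : ↥(flickerPH σ J c)) ∈ flickerHK σ J c um} = 0 := by
  have h2 : (2 : K) ≠ 0 := fun h => by have := hd.v2; rw [h, map_zero] at this; exact zero_ne_one this
  refine natCard_cosets_eq_zero_of_forall_not σ fun p hp hmem => ?_
  obtain ⟨u, x, w, hpm, hvu, hvx, hσx, hvw, hσw⟩ := exists_coe_eq_borel_of_mem_flickerPH σ hJ hd hc hp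
  have hu0 : u ≠ 0 := fun h => by rw [h, map_zero] at hvu; exact zero_ne_one hvu
  have hσu0 : σ u ≠ 0 := fun h => hu0 (by rw [← hd.σσ u, h, map_zero])
  have hw0 : w ≠ 0 := fun h => by rw [h, map_zero] at hvw; exact zero_ne_one hvw
  have hpH : p ∈ Subgroup.centralizer ({c} : Set ↥(unitaryGroupOfForm σ J)) := ((mem_flickerPH_iff h2 hc).1 hp).1.1
  obtain ⟨-, h₂, h₃, h₄⟩ := (borel_conj_mem_flickerHK_iff σ hJ hd hy m hu0 hσu0 hw0 hum hpm hτ hpH hτH).1 hmem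
  have hn : Valued.v (u * σ u) = 1 := by rw [map_mul, hd.vσ, hvu, mul_one]
  rcases hbad with hs | ⟨hne, hbig⟩
  · have := (two_congruences_iff_of_v_B₂_le (ϖ := ϖ) hB₂m hn hvx).1 ⟨h₂, h₃⟩
    exact absurd hs (not_lt.2 this)
  · have h1x := v_one_sub_sq_eq_one σ hd.vσ hd.v2 hσx hvx
    exact not_condition_four_of_ne σ hd hj hB₂0 hn h1x rfl hne hbig h₄

/-- **Regime «everything solves» as a coset count**: if `|A − b| ≤ |t|²` and `|B₂| ≤ |t|²` (`2m ≤ N₊`, `2m ≤ ν`) then EVERY coset conjugates `τ` into `H^K_m`, and the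
count is the index `[P_H : P_H ∩ H^K_m]`. [cite: Flicker1998UnitaryFL, Prop. 10 p. 86; Prop. 8 p. 84] -/
theorem natCard_cosets_eq_index_of_le (hJ : J = (StdForm.antidiagonal 3).over K) (hd : LocalConjDatum σ ϖ) {y : K} (hy : y * σ y = -2) (m : ℕ)
    {c um τ : ↥(unitaryGroupOfForm σ J)} (hc : ((c : GL (Fin 3) K) : Matrix (Fin 3) (Fin 3) K) = !![1, 0, 0; 0, -1, 0; 0, 0, 1])
    (hum : ((um : GL (Fin 3) K) : Matrix (Fin 3) (Fin 3) K) = !![ϖ ^ m, y, (ϖ ^ m)⁻¹; 0, 1, -σ y * (ϖ ^ m)⁻¹; 0, 0, (ϖ ^ m)⁻¹])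
    {A B₂ b : K} {j : ℕ}
    (hτ : ((τ : GL (Fin 3) K) : Matrix (Fin 3) (Fin 3) K) = !![A, 0, B₂ * ϖ ^ (2 * j); 0, b, 0; B₂, 0, A])
    (hτH : τ ∈ Subgroup.centralizer ({c} : Set ↥(unitaryGroupOfForm σ J)))
    (hs : Valued.v (A - b) ≤ Valued.v (ϖ ^ m) * Valued.v (ϖ ^ m)) (hB₂ : Valued.v B₂ ≤ Valued.v (ϖ ^ m) * Valued.v (ϖ ^ m)) :
    Nat.card {y : ↥(flickerPH σ J c) ⧸ (flickerHK σ J c um).subgroupOf (flickerPH σ J c) //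
      ((Quotient.out y : ↥(flickerPH σ J c)) : ↥(unitaryGroupOfForm σ J))⁻¹ * τ * (Quotient.out y : ↥(flickerPH σ J c)) ∈ flickerHK σ J c um} =
      ((flickerHK σ J c um).subgroupOf (flickerPH σ J c)).index := by
  have h2 : (2 : K) ≠ 0 := fun h => by have := hd.v2; rw [h, map_zero] at this; exact zero_ne_one this
  have ht1 : Valued.v (ϖ ^ m) ≤ 1 := hd.v_pow_le_one m
  have ht2 : Valued.v (ϖ ^ m) * Valued.v (ϖ ^ m) ≤ Valued.v (ϖ ^ m) := by simpa using mul_le_mul' ht1 (le_refl (Valued.v (ϖ ^ m)))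
  refine natCard_cosets_eq_index_of_forall σ fun p hp => ?_
  obtain ⟨u, x, w, hpm, hvu, hvx, hσx, hvw, hσw⟩ := exists_coe_eq_borel_of_mem_flickerPH σ hJ hd hc hp
  have hu0 : u ≠ 0 := fun h => by rw [h, map_zero] at hvu; exact zero_ne_one hvu
  have hσu0 : σ u ≠ 0 := fun h => hu0 (by rw [← hd.σσ u, h, map_zero])
  have hw0 : w ≠ 0 := fun h => by rw [h, map_zero] at hvw; exact zero_ne_one hvw
  have hpH : p ∈ Subgroup.centralizer ({c} : Set ↥(unitaryGroupOfForm σ J)) := ((mem_flickerPH_iff h2 hc).1 hp).1.1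
  have hn : Valued.v (u * σ u) = 1 := by rw [map_mul, hd.vσ, hvu, mul_one]
  have hB₂m : Valued.v B₂ ≤ Valued.v (ϖ ^ m) := le_trans hB₂ ht2
  refine (borel_conj_mem_flickerHK_iff σ hJ hd hy m hu0 hσu0 hw0 hum hpm hτ hpH hτH).2 ⟨?_, ?_⟩
  · rw [map_mul, hn, one_mul]; exact le_trans hB₂m ht1
  obtain ⟨h₂, h₃⟩ := (two_congruences_iff_of_v_B₂_le (ϖ := ϖ) hB₂m hn hvx).2 (le_trans hs ht2)
  exact ⟨h₂, h₃, condition_four_of_le_sq σ hd hn hvx rfl hs hB₂⟩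

end UnitaryGroup

end Literature.NumberTheory.Automorphic
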